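import Summits.Ventures.CertifiedManyBodySolver.Theorems.TcThermcert1FreeCanonicalFugacityTimeReversal
import HarnessLib

/-!
# Free canonical gas at `β·t = 8` — the positivity (crude) insertion bound for complex two-fugacity traces

Helper file for route `TcThermcert1` (crux K1′ `ThermalStiffnessCeilingU8b8_le_7o44`, item `stmt-Ventures-24560`), crux idea
`free-canonical-b8-rung`. For EVERY sector-preserving Hermitian `H` (any `U`), every operator `B` and all complex fugacities `z, w`:

  `|tr( diag(z^{N↑} w^{N↓}) e^{−βH} B )| ≤ ‖B‖ · tr( diag(|z|^{N↑} |w|^{N↓}) e^{−βH} )`,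

i.e. `|T_B(z, w)| ≤ ‖B‖ · Ξ(|z|, |w|)`: the twisted trace with an insertion is bounded by the operator norm of the insertion times the
UNtwisted two-fugacity partition function at the radii. Proof: sector decomposition `diag(z^{N↑}w^{N↓}) = Σ z^M w^N P_{M,N}`
(`diagonal_fugacity_eq_sum_spinSectorProj`) and the tree's state bound `|tr(P_{M,N} e^{−βH} B)| ≤ ‖B‖ Re tr(P_{M,N} e^{−βH})`
(positivity of the projected Gibbs weight). This is the insertion bound "all positivity gives" (critic hubbard-floor-crit-1 g11 §5.1);
the scheme's open step S6 is its CONDITIONAL sharpening by the Gaussian factor `e^{−(1−cos φ)(σ² − O(|supp B|))}`, NOT proved here.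

HONEST LABEL: finite-dimensional positivity; a step of a RUNG (`U = 0`, BC5-type witness for the C8 bet), reach at `U = 8` ZERO; decides
nothing about K1/K1′/`T_c`; superconductivity in the Hubbard model is NOT proved or advanced by this file beyond the rung.
-/

noncomputable section

namespace Summit.Ventures.CertifiedManyBodySolver.Theorems.TcThermcert1.FreeCanonicalB8

open NormedSpace Matrix Finset
open Literature.MathematicalPhysics.QuantumLattice
open Summit.Ventures.CertifiedManyBodySolver.Theorems.TcThermcert1.FreeGasCurrentClustering
open scoped Matrix.Norms.L2Operator ComplexOrder

variable {Λ : Type*} [LinearOrder Λ] [Fintype Λ]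

/-- The untwisted two-fugacity partition function at non-negative real radii is the non-negative real
`Σ_{M,N} r^M s^N Re tr(P_{M,N} e^{−βH})`. -/
theorem trace_diagonal_fugacity_real_mul_gibbsWeight_eq {H : Matrix (Finset (Orb Λ)) (Finset (Orb Λ)) ℂ} (hH : H.IsHermitian)
    (hP : PreservesSectors H) (β r s : ℝ) :
    (diagonal (fun t : Finset (Orb Λ) => (r : ℂ) ^ (upPart t).card * (s : ℂ) ^ (downPart t).card) * gibbsWeight β H).trace =
      ((∑ M ∈ Finset.range (Fintype.card Λ + 1), ∑ N ∈ Finset.range (Fintype.card Λ + 1),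
        r ^ M * s ^ N * ((spinSectorProj M N * gibbsWeight β H).trace).re : ℝ) : ℂ) := by
  rw [diagonal_fugacity_eq_sum_spinSectorProj (r : ℂ) (s : ℂ)]
  simp only [Finset.sum_mul, smul_mul_assoc, Matrix.trace_sum, Matrix.trace_smul, smul_eq_mul]
  push_cast
  refine Finset.sum_congr rfl fun M _ => Finset.sum_congr rfl fun N _ => ?_
  rw [← trace_spinSectorProj_mul_gibbsWeight_eq_re hH hP β M N]

/-- **Positivity insertion bound for complex two-fugacity traces.** For `H` Hermitian and sector-preserving, every operator `B` and all
complex `z, w`: `|tr(diag(z^{N↑}w^{N↓}) e^{−βH} B)| ≤ ‖B‖ · Σ_{M,N} |z|^M |w|^N Re tr(P_{M,N} e^{−βH})` (`= ‖B‖ · Ξ(|z|,|w|)`, the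
untwisted two-fugacity partition function at the radii, by `trace_diagonal_fugacity_real_mul_gibbsWeight_eq`). -/
theorem norm_trace_diagonal_fugacity_mul_gibbsWeight_mul_le {H : Matrix (Finset (Orb Λ)) (Finset (Orb Λ)) ℂ} (hH : H.IsHermitian)
    (hP : PreservesSectors H) (β : ℝ) (z w : ℂ) (B : Matrix (Finset (Orb Λ)) (Finset (Orb Λ)) ℂ) :
    ‖(diagonal (fun t : Finset (Orb Λ) => z ^ (upPart t).card * w ^ (downPart t).card) * gibbsWeight β H * B).trace‖ ≤
      ‖B‖ * ∑ M ∈ Finset.range (Fintype.card Λ + 1), ∑ N ∈ Finset.range (Fintype.card Λ + 1),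
        ‖z‖ ^ M * ‖w‖ ^ N * ((spinSectorProj M N * gibbsWeight β H).trace).re := by
  rw [diagonal_fugacity_eq_sum_spinSectorProj z w]
  simp only [Finset.sum_mul, smul_mul_assoc, Matrix.trace_sum, Matrix.trace_smul, smul_eq_mul]
  rw [Finset.mul_sum]
  refine (norm_sum_le _ _).trans (Finset.sum_le_sum fun M _ => ?_)
  rw [Finset.mul_sum]
  refine (norm_sum_le _ _).trans (Finset.sum_le_sum fun N _ => ?_)
  rw [norm_mul, norm_mul, norm_pow, norm_pow]
  have hB := norm_trace_spinSectorProj_mul_gibbsWeight_mul_le hH hP β M N B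
  have hZ : 0 ≤ ((spinSectorProj M N * gibbsWeight β H).trace).re :=
    (Complex.nonneg_iff.1 (trace_spinSectorProj_mul_gibbsWeight_nonneg hH hP β M N)).1
  calc ‖z‖ ^ M * ‖w‖ ^ N * ‖(spinSectorProj M N * gibbsWeight β H * B).trace‖
      ≤ ‖z‖ ^ M * ‖w‖ ^ N * (‖B‖ * ((spinSectorProj M N * gibbsWeight β H).trace).re) :=
        mul_le_mul_of_nonneg_left hB (by positivity)
    _ = ‖B‖ * (‖z‖ ^ M * ‖w‖ ^ N * ((spinSectorProj M N * gibbsWeight β H).trace).re) := by ring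

/-- **`|T_B(z,w)| ≤ ‖B‖ · Ξ(|z|,|w|)`**, closed form: the bound of `norm_trace_diagonal_fugacity_mul_gibbsWeight_mul_le` IS the
(norm of the) untwisted two-fugacity trace at the radii `(|z|, |w|)`. -/
theorem norm_trace_diagonal_fugacity_mul_gibbsWeight_mul_le' {H : Matrix (Finset (Orb Λ)) (Finset (Orb Λ)) ℂ} (hH : H.IsHermitian)
    (hP : PreservesSectors H) (β : ℝ) (z w : ℂ) (B : Matrix (Finset (Orb Λ)) (Finset (Orb Λ)) ℂ) :
    ‖(diagonal (fun t : Finset (Orb Λ) => z ^ (upPart t).card * w ^ (downPart t).card) * gibbsWeight β H * B).trace‖ ≤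
      ‖B‖ * ‖(diagonal (fun t : Finset (Orb Λ) => (‖z‖ : ℂ) ^ (upPart t).card * (‖w‖ : ℂ) ^ (downPart t).card) *
        gibbsWeight β H).trace‖ := by
  rw [trace_diagonal_fugacity_real_mul_gibbsWeight_eq hH hP β ‖z‖ ‖w‖, Complex.norm_real, Real.norm_of_nonneg]
  · exact norm_trace_diagonal_fugacity_mul_gibbsWeight_mul_le hH hP β z w B
  · exact Finset.sum_nonneg fun M _ => Finset.sum_nonneg fun N _ => mul_nonneg (by positivity)
      (Complex.nonneg_iff.1 (trace_spinSectorProj_mul_gibbsWeight_nonneg hH hP β M N)).1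

end Summit.Ventures.CertifiedManyBodySolver.Theorems.TcThermcert1.FreeCanonicalB8

end
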